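import Mathlib
import HarnessLib
import Summits.ValiantsHypothesis.ValiantsHypothesis.Theorems.LacunarySymmetroidMatrixDescartesProductPlusOneOneBumpLine

/-!
# LINE (A) `product_plus_one` — THE MIXED-RATE ONE-BUMP CELL, the counts: ≤ 2 roots of `W(∏ fewnomial)` in the window, ≤ 3 of
# `eulerNumerator d a l₀` for every coupling (LINE currency, K = 3)

Crux item stmt-ValiantsHypothesis-18050; owner memo §21.2 `MixedRateOneBumpCellK3`.  Wrappers of ✓/⧗ `oneBump_company_wronskian_no_three_zeros`
(`…ProductPlusOneOneBumpLine`; menu there): bump row `j₀` ∈ {one-signed binomial on any pair, switched incoherent trinomial (`f(u) < 0`), unswitched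
coherent trinomial (`f(v) > 0`)}, every other row ∈ {one-change binomial on any pair with `0 < f(u)f(v)`, unswitched incoherent (`f(v) > 0`), switched
coherent (`f(u) < 0`)}, window `[u,v] ⊂ (0,∞)`.
* ★ `oneBump_company_wronskian_roots_le_two`;  ★★ `oneBump_company_eulerNumerator_roots_le_three` (✓ `eulerNumerator_roots_Icc_le_wronskian_roots_add_one`).
HONEST FRAMING: one bump; nothing here proves `WronskianBudgetK3` / `OneChangeFloorK3` / the stubs / 18050 / `MatrixDescartes`; `VP ≠ VNP` NOT proved.
No definitions, no named facts.
-/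

set_option linter.dupNamespace false

namespace Summit.ValiantsHypothesis.ValiantsHypothesis.Theorems.LacunarySymmetroidMatrixDescartes

namespace ProductPlusOne

open Finset Polynomial
open scoped BigOperators Polynomial

/-- ★ **THE MIXED-RATE ONE-BUMP CELL: at most TWO zeros of `W(∏ f_j)` in the open window `(u,v)`.** [this file's theorem] -/
theorem oneBump_company_wronskian_roots_le_two {m : ℕ} (d : Fin 3 → ℕ) (e₁ e₂ : ℕ)
    (he₁ : d 1 = d 0 + e₁ + 1) (he₂ : d 2 = d 1 + e₂ + 1) (a : Fin m → Fin 3 → ℝ) (j₀ : Fin m) {u v : ℝ} (hu : 0 < u)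
    (hbump : (a j₀ 2 = 0 ∧ 0 < a j₀ 0 * a j₀ 1) ∨ (a j₀ 0 = 0 ∧ 0 < a j₀ 1 * a j₀ 2) ∨ (a j₀ 1 = 0 ∧ 0 < a j₀ 0 * a j₀ 2) ∨
      (0 < a j₀ 0 ∧ a j₀ 1 < 0 ∧ a j₀ 2 < 0 ∧ (∑ l, C (a j₀ l) * X ^ (d l) : ℝ[X]).eval u < 0) ∨
      (0 < a j₀ 0 ∧ 0 < a j₀ 1 ∧ a j₀ 2 < 0 ∧ 0 < (∑ l, C (a j₀ l) * X ^ (d l) : ℝ[X]).eval v))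
    (hbg : ∀ j, j ≠ j₀ →
      (((a j 2 = 0 ∧ a j 0 * a j 1 < 0) ∨ (a j 0 = 0 ∧ a j 1 * a j 2 < 0) ∨ (a j 1 = 0 ∧ a j 0 * a j 2 < 0)) ∧
          0 < (∑ l, C (a j l) * X ^ (d l) : ℝ[X]).eval u * (∑ l, C (a j l) * X ^ (d l) : ℝ[X]).eval v) ∨
      (0 < a j 0 ∧ a j 1 ≤ 0 ∧ a j 2 ≤ 0 ∧ a j 1 + a j 2 < 0 ∧ 0 < (∑ l, C (a j l) * X ^ (d l) : ℝ[X]).eval v) ∨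
      (0 < a j 0 ∧ 0 < a j 1 ∧ a j 2 < 0 ∧ (∑ l, C (a j l) * X ^ (d l) : ℝ[X]).eval u < 0)) :
    (((∏ j, ∑ l, C (a j l) * X ^ (d l) : ℝ[X]) * (X * derivative (X * derivative (∏ j, ∑ l, C (a j l) * X ^ (d l) : ℝ[X])))
        - (X * derivative (∏ j, ∑ l, C (a j l) * X ^ (d l) : ℝ[X])) ^ 2).roots.toFinset.filter (fun w => u < w ∧ w < v)).card ≤ 2 := by
  classical
  set W : ℝ[X] := (∏ j, ∑ l, C (a j l) * X ^ (d l) : ℝ[X]) * (X * derivative (X * derivative (∏ j, ∑ l, C (a j l) * X ^ (d l) : ℝ[X])))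
      - (X * derivative (∏ j, ∑ l, C (a j l) * X ^ (d l) : ℝ[X])) ^ 2 with hWdef
  by_contra hgt
  push Not at hgt
  obtain ⟨y₁, hy₁, y₂, hy₂, y₃, hy₃, h12', h23⟩ := exists_three_lt_of_card (T := W.roots.toFinset.filter (fun w => u < w ∧ w < v)) hgt
  by_cases hW0 : W = 0
  · rw [hW0, roots_zero, Multiset.toFinset_zero, Finset.filter_empty] at hy₁; exact absurd hy₁ (Finset.notMem_empty _)
  rw [mem_filter, Multiset.mem_toFinset, mem_roots hW0] at hy₁ hy₂ hy₃
  refine oneBump_company_wronskian_no_three_zeros d e₁ e₂ he₁ he₂ a j₀ hu hbump hbg hy₁.2.1.le h12' h23 hy₃.2.2.le ?_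
  intro x hx
  simp only [Set.mem_insert_iff, Set.mem_singleton_iff] at hx
  rcases hx with h | h | h <;> subst h
  · exact hy₁.1
  · exact hy₂.1
  · exact hy₃.1

/-- ★★ **THE MIXED-RATE ONE-BUMP CELL, Euler currency: at most THREE roots of `eulerNumerator d a l₀` on `[u,v]`, for EVERY coupling `l₀`.** [this file's theorem] -/
theorem oneBump_company_eulerNumerator_roots_le_three {m : ℕ} (d : Fin 3 → ℕ) (e₁ e₂ : ℕ)
    (he₁ : d 1 = d 0 + e₁ + 1) (he₂ : d 2 = d 1 + e₂ + 1) (a : Fin m → Fin 3 → ℝ) (j₀ : Fin m) (l₀ : Fin 3) {u v : ℝ} (hu : 0 < u)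
    (huv : u ≤ v)
    (hbump : (a j₀ 2 = 0 ∧ 0 < a j₀ 0 * a j₀ 1) ∨ (a j₀ 0 = 0 ∧ 0 < a j₀ 1 * a j₀ 2) ∨ (a j₀ 1 = 0 ∧ 0 < a j₀ 0 * a j₀ 2) ∨
      (0 < a j₀ 0 ∧ a j₀ 1 < 0 ∧ a j₀ 2 < 0 ∧ (∑ l, C (a j₀ l) * X ^ (d l) : ℝ[X]).eval u < 0) ∨
      (0 < a j₀ 0 ∧ 0 < a j₀ 1 ∧ a j₀ 2 < 0 ∧ 0 < (∑ l, C (a j₀ l) * X ^ (d l) : ℝ[X]).eval v))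
    (hbg : ∀ j, j ≠ j₀ →
      (((a j 2 = 0 ∧ a j 0 * a j 1 < 0) ∨ (a j 0 = 0 ∧ a j 1 * a j 2 < 0) ∨ (a j 1 = 0 ∧ a j 0 * a j 2 < 0)) ∧
          0 < (∑ l, C (a j l) * X ^ (d l) : ℝ[X]).eval u * (∑ l, C (a j l) * X ^ (d l) : ℝ[X]).eval v) ∨
      (0 < a j 0 ∧ a j 1 ≤ 0 ∧ a j 2 ≤ 0 ∧ a j 1 + a j 2 < 0 ∧ 0 < (∑ l, C (a j l) * X ^ (d l) : ℝ[X]).eval v) ∨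
      (0 < a j 0 ∧ 0 < a j 1 ∧ a j 2 < 0 ∧ (∑ l, C (a j l) * X ^ (d l) : ℝ[X]).eval u < 0)) :
    ((∑ j, (∑ l, C (a j l * ((d l : ℝ) - d l₀)) * X ^ (d l)) * ∏ i ∈ Finset.univ.erase j, (∑ l, C (a i l) * X ^ (d l))
        : ℝ[X]).roots.toFinset.filter (fun t => u ≤ t ∧ t ≤ v)).card ≤ 3 := by
  classical
  -- no row vanishes on the window: two roots `x₁ < x₂` of `W` at a vanishing point are not needed; we re-run the pointwise facts cheaply via
  -- the no-three-zeros theorem's sibling: if some `f_j(t) = 0` with `t ∈ [u,v]`, the menu is violated.  We extract that from the menu directly.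
  have hd := fin3_support_eq_gaps d e₁ e₂ he₁ he₂
  have hev : ∀ j x, (∑ l, C (a j l) * X ^ (d l) : ℝ[X]).eval x
        = x ^ (d 0) * (a j 0 - (-(a j 1)) * x ^ (e₁ + 1) - (-(a j 2)) * x ^ (e₁ + e₂ + 2)) := by
    intro j x
    have h := (eval_trinomial_three (d 0) (e₁ + 1) (e₁ + e₂ + 2) (a j) x).1
    rw [hd] at h; rw [h]; ring
  have hv0 : 0 < v := hu.trans_le huv
  have incoh_neg : ∀ (A' B' C' : ℝ), 0 ≤ B' → 0 ≤ C' → ∀ (y₀ y : ℝ), 0 < y₀ → y₀ ≤ y →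
      A' - B' * y₀ ^ (e₁ + 1) - C' * y₀ ^ (e₁ + e₂ + 2) < 0 → A' - B' * y ^ (e₁ + 1) - C' * y ^ (e₁ + e₂ + 2) < 0 := by
    intro A' B' C' hB' hC' y₀ y hy₀ hle h
    have hm1 : B' * y₀ ^ (e₁ + 1) ≤ B' * y ^ (e₁ + 1) := mul_le_mul_of_nonneg_left (pow_le_pow_left₀ hy₀.le hle _) hB'
    have hm2 : C' * y₀ ^ (e₁ + e₂ + 2) ≤ C' * y ^ (e₁ + e₂ + 2) := mul_le_mul_of_nonneg_left (pow_le_pow_left₀ hy₀.le hle _) hC'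
    linarith
  have hP : ∀ t ∈ Set.Icc u v, (∏ j, (∑ l, C (a j l) * X ^ (d l) : ℝ[X])).eval t ≠ 0 := by
    intro t ht
    have ht0 : 0 < t := hu.trans_le ht.1
    rw [eval_prod]
    refine Finset.prod_ne_zero_iff.2 fun j _ => ?_
    by_cases hj : j = j₀
    · subst hj
      rcases hbump with ⟨h2z, h01⟩ | ⟨h0z, h12z⟩ | ⟨h1z, h02⟩ | ⟨hA, h1, h2, hswu⟩ | ⟨hA, h1, h2, hunv⟩
      · rw [hev, h2z]
        have hxp : 0 < t ^ (e₁ + 1) := pow_pos ht0 _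
        refine mul_ne_zero (pow_ne_zero _ ht0.ne') ?_
        intro h
        have ha0 : a j 0 = -(a j 1 * t ^ (e₁ + 1)) := by linarith
        rw [ha0] at h01
        nlinarith [mul_nonneg (sq_nonneg (a j 1)) hxp.le]
      · rw [hev, h0z]
        have : (0 : ℝ) - (-(a j 1)) * t ^ (e₁ + 1) - (-(a j 2)) * t ^ (e₁ + e₂ + 2) = t ^ (e₁ + 1) * (a j 1 + a j 2 * t ^ (e₂ + 1)) := by ring
        rw [this]
        have hxp : 0 < t ^ (e₂ + 1) := pow_pos ht0 _
        refine mul_ne_zero (pow_ne_zero _ ht0.ne') (mul_ne_zero (pow_ne_zero _ ht0.ne') ?_)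
        intro h
        have ha1 : a j 1 = -(a j 2 * t ^ (e₂ + 1)) := by linarith
        rw [ha1] at h12z
        nlinarith [mul_nonneg (sq_nonneg (a j 2)) hxp.le]
      · rw [hev, h1z]
        have hxp : 0 < t ^ (e₁ + e₂ + 2) := pow_pos ht0 _
        refine mul_ne_zero (pow_ne_zero _ ht0.ne') ?_
        intro h
        have ha0 : a j 0 = -(a j 2 * t ^ (e₁ + e₂ + 2)) := by linarith
        rw [ha0] at h02
        nlinarith [mul_nonneg (sq_nonneg (a j 2)) hxp.le]
      · rw [hev] at hswu ⊢
        have h1' : a j 0 - (-(a j 1)) * u ^ (e₁ + 1) - (-(a j 2)) * u ^ (e₁ + e₂ + 2) < 0 :=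
          ((mul_neg_iff.1 hswu).resolve_right (fun h' => absurd (pow_pos hu _) (not_lt.2 h'.1.le))).2
        exact mul_ne_zero (pow_ne_zero _ ht0.ne')
          (incoh_neg (a j 0) (-(a j 1)) (-(a j 2)) (by linarith) (by linarith) u t hu ht.1 h1').ne
      · rw [hev] at hunv ⊢
        have h3 : 0 < a j 0 - (-(a j 1)) * v ^ (e₁ + 1) - (-(a j 2)) * v ^ (e₁ + e₂ + 2) := (mul_pos_iff_of_pos_left (pow_pos hv0 _)).1 hunv
        exact mul_ne_zero (pow_ne_zero _ ht0.ne')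
          (coherent_value_pos_of_le e₁ e₂ (a j 0) (-(a j 1)) (-(a j 2)) hA.le (by linarith) ht0 ht.2 h3).ne'
    · rcases hbg j hj with ⟨hbin, hprod⟩ | ⟨_, h1, h2, _, hunv⟩ | ⟨hA, h1, _, hswu⟩
      · -- the binomial keeps the sign of `f(u)`: `f(u)·f(t) > 0`
        intro h
        have key : ∀ (α β : ℝ) (n k : ℕ), (∀ y, 0 < y → (∑ l, C (a j l) * X ^ (d l) : ℝ[X]).eval y = y ^ k * (α + β * y ^ n)) → False := by
          intro α β n k hg
          rw [hg u hu, hg v hv0] at hprod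
          have : u ^ k * (α + β * u ^ n) * (v ^ k * (α + β * v ^ n)) = (u ^ k * v ^ k) * ((α + β * u ^ n) * (α + β * v ^ n)) := by ring
          rw [this] at hprod
          have hprod' := (mul_pos_iff_of_pos_left (by positivity)).1 hprod
          have hgx := binomial_sign_const α β n hu hprod' ht
          rw [hg t ht0] at h
          rcases mul_eq_zero.1 h with h' | h'
          · exact absurd h' (pow_ne_zero _ ht0.ne')
          · rw [h', mul_zero] at hgx; exact lt_irrefl 0 hgx
        rcases hbin with ⟨h2z, _⟩ | ⟨h0z, _⟩ | ⟨h1z, _⟩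
        · exact key (a j 0) (a j 1) (e₁ + 1) (d 0) (fun y _ => by rw [hev, h2z]; ring)
        · exact key (a j 1) (a j 2) (e₂ + 1) (d 0 + (e₁ + 1)) (fun y _ => by rw [hev, h0z]; ring)
        · exact key (a j 0) (a j 2) (e₁ + e₂ + 2) (d 0) (fun y _ => by rw [hev, h1z]; ring)
      · rw [hev] at hunv ⊢
        have h3 : 0 < a j 0 - (-(a j 1)) * v ^ (e₁ + 1) - (-(a j 2)) * v ^ (e₁ + e₂ + 2) := (mul_pos_iff_of_pos_left (pow_pos hv0 _)).1 hunv
        have hm1 : a j 1 * v ^ (e₁ + 1) ≤ a j 1 * t ^ (e₁ + 1) := mul_le_mul_of_nonpos_left (pow_le_pow_left₀ ht0.le ht.2 _) h1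
        have hm2 : a j 2 * v ^ (e₁ + e₂ + 2) ≤ a j 2 * t ^ (e₁ + e₂ + 2) := mul_le_mul_of_nonpos_left (pow_le_pow_left₀ ht0.le ht.2 _) h2
        exact mul_ne_zero (pow_ne_zero _ ht0.ne') (ne_of_gt (by linarith))
      · rw [hev] at hswu ⊢
        have h1' : a j 0 - (-(a j 1)) * u ^ (e₁ + 1) - (-(a j 2)) * u ^ (e₁ + e₂ + 2) < 0 :=
          ((mul_neg_iff.1 hswu).resolve_right (fun h' => absurd (pow_pos hu _) (not_lt.2 h'.1.le))).2
        exact mul_ne_zero (pow_ne_zero _ ht0.ne')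
          (coherent_value_neg_of_ge e₁ e₂ (a j 0) (-(a j 1)) (-(a j 2)) hA.le (by linarith) hu ht.1 h1').ne
  have h1 := eulerNumerator_roots_Icc_le_wronskian_roots_add_one d a l₀ hu hP
  have h2 := oneBump_company_wronskian_roots_le_two d e₁ e₂ he₁ he₂ a j₀ hu hbump hbg
  omega

end ProductPlusOne

end Summit.ValiantsHypothesis.ValiantsHypothesis.Theorems.LacunarySymmetroidMatrixDescartes
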